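import Summits.BirchSwinnertonDyer.BirchSwinnertonDyer.Theorems.KolyvaginDepthDoorDepthTableJLSRowsPrint
import Summits.BirchSwinnertonDyer.BirchSwinnertonDyer.Theorems.KolyvaginDepthDoorKolyvaginDepthSupplyDoorOfDatumPrintTwist
import Literature.NumberTheory.DiophantineGeometry.LocalReductionIsSemistableProofs
import HarnessLib

/-!
# Route `KolyvaginDepthDoor` — THE THREE PRINTED DEPTH-TABLE BITS (Jetchev–Lauter–Stein 2009, Prop. 3.10
# / Rem. 3.11: `389a1`, `709a1`, `718b1` at `(p, d_K, ℓ) = (3, −7, 5)`) IN THE LINE'S FINAL CURRENCY: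
# (γ) + the published computation ONLY (F1 dropped — the Kodaira–Néron door), WITH the exact twist
# reading «`#Sel_3(E^{(−7)}/ℚ) ≤ 3`» (crux `KolyvaginDepthSupplyKN`, stmt-BirchSwinnertonDyer-22820)

Helper file of the lead prover of line `levelone` (kdd-p1 g15; `--supports stmt-BirchSwinnertonDyer-22820
--as helper`); it closes nothing and BSD is not proved by it.

The depth table's only rows WITH A COMPUTED BIT IN PRINT are Jetchev–Lauter–Stein's three `p = 3`
verifications of Kolyvagin's conjecture (arXiv:0707.0032 §3.6: for `E ∈ {389a1, 709a1, 718b1}`,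
`K = ℚ(√−7)`, `ℓ = 5`: "there is no `Q ∈ E(K[5])` with `3Q = P_5`", hence `κ_{5,1} ≠ 0`), typed as the
Literature fact `JetchevLauterStein2009_kolyvaginClass_five_ne_zero_at_three` (`hJ`, datum currency).
The lineage read them three times: g3 (`jlsRow_3_neg7_5`, mod Kolyvagin 1991 Thm. 4 `hK`, XL), g7
(`…_ofLeaves`, mod five McCallum/Gross leaves), g8 (`…_print`, mod (γ) + F1 = Gross 1991 `E⁰` lemma).
Since then the door runs on the Kodaira–Néron cell from (γ) ALONE (g9: `p ∤ ord_v(Δ_min)` at the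
multiplicative places replaces F1; kit `depthRow_print_of_datum_of_intModel_certificate`, any odd `p`,
with — at `p = 3` only — «no additive place of type IV / IV*»), and the twist side of a bit is read
EXACTLY (`natCard_selmerGroup_twist_le_of_kolyvaginClass_ne_zero_of_datum_kodairaNeron`). All three
curves are semistable (`389`, `709` prime; `718 = 2·359`, `Δ = 2⁴·359`), so they have NO additive place
and `3 ∤ ord_v(Δ_min) ∈ {1, 4}`: the `p = 3` door applies verbatim. This file re-issues the three rows:

* `C389a1.AtThree.jlsRow_3_neg7_5_kodairaNeron`, `C709a1.AtThree.…`, `C718b1.AtThree.…` — binders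
  `(h372 : (γ)) (hJ : JLS)` ONLY (no F1, no leaf, no `hK`), for ANY imaginary quadratic `K` with
  `d_K = −7`: `corank_{ℤ_3} Ш(E/ℚ)[3^∞] = 0`, `rank_ℤ E(ℚ) = 2`, `rank_ℤ E^{(−7)}(ℚ) ≤ 1`, `E(ℚ)[3] = 0`,
  `Ш(E/ℚ)[3] = 0`, `#Sel_3(E/ℚ) = 9`, AND THE TWIST READING `#Sel_3(E^{(−7)}/ℚ) ≤ 3` (new: the
  printed bit also certifies `dim_𝔽₃ Sel_3 ≤ 1` for the `−7`-twists `389a1`, `709a1`, `718b1` ⊗ χ_{−7},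
  conductors `19061`, `34741`, `35182`);
* `jlsRows_kodairaNeron` — the three rows as one statement.

So the instrument's calibration rows now cost exactly what every `p ≥ 5` row costs: (γ) + the bit.
`p = 3` CALIBRATES (the crux has `p ≥ 5`); CONDITIONAL on (γ) and `hJ`; per curve; BSD is NOT proved
by any of this.

References: [JetchevLauterStein2009] §3.6 Prop. 3.10, Rem. 3.11 (arXiv:0707.0032 p. 8); [GrossLMS1991]
Prop. 3.7 (2), §5 (5.1); [Kolyvagin1991MathAnn] Thm. 2.3; [McCallumLMS1991] §§2–5; [SilvermanAEC2009]
VII.5 Prop. 5.1, VII.6.1; [CremonaAlgorithms1997] Table 1.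
-/

set_option linter.dupNamespace false

noncomputable section

open scoped Classical NumberField

namespace Summit.BirchSwinnertonDyer.BirchSwinnertonDyer.Theorems.KolyvaginDepthDoor

open Literature.NumberTheory.EllipticCurves Literature.NumberTheory.EllipticCurves.ModularForms
  Literature.NumberTheory.EllipticCurves.McCallum1991 WeierstrassCurve IsDedekindDomain
open Summit.BirchSwinnertonDyer.BirchSwinnertonDyer.Rank2Observatory
open Summit.BirchSwinnertonDyer.BirchSwinnertonDyer.Rank1Residual

namespace C389a1.AtThree

/-- **JLS ROW `389a1` at `(p, d_K, ℓ) = (3, −7, 5)` ON THE KODAIRA–NÉRON DOOR: (γ) + the published bit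
ONLY, with the twist reading.** Granted (γ) (Gross 1991 Prop. 3.7 (2)) and the published computation `hJ`
(JLS 2009 Prop. 3.10: a datum `d` of conductor `5` with `d.kolyvaginClass _ 1 ≠ 0`), for ANY imaginary
quadratic `K` with `d_K = −7`: `corank_{ℤ_3} Ш(E/ℚ)[3^∞] = 0`, `rank_ℤ E(ℚ) = 2`, `rank_ℤ E^{(−7)}(ℚ) ≤ 1`,
`E(ℚ)[3] = 0`, `Ш(E/ℚ)[3] = 0`, `#Sel_3(E/ℚ) = 3²`, and `#Sel_3(E^{(−7)}/ℚ) ≤ 3`. Side conditions all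
kernel theorems: `3 ∈ B(E)` (`hasSurjectiveModNGaloisRep_pow_3`), non-CM, Heegner hypothesis for
`(N, −7)`, `5` a Kolyvagin prime with `M(5) ≥ 1` (`card_5`), `2 ≤ rank` (kernel certificate), the
Kodaira–Néron table of `Δ = 389` at `3`, and NO additive place (semistable: `gcd(c₄, Δ) = 1`).
Compare g8's `jlsRow_3_neg7_5_print` (one print input more: F1). CONDITIONAL on (γ) and `hJ`;
calibration (`p = 3 < 5`), not an instance of the crux; BSD is not proved by it.
[cite: JetchevLauterStein2009, §3.6 Prop. 3.10 (arXiv:0707.0032 p. 8)] [cite: GrossLMS1991, Prop. 3.7 (2), §5 (5.1)]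
[cite: Kolyvagin1991MathAnn, Thm. 2.3] [cite: CremonaAlgorithms1997, Table 1 (389a1)] -/
theorem jlsRow_3_neg7_5_kodairaNeron
    (h372 : GrossLMS1991.prop37_2_frobeniusCongruence)
    (hJ : Literature.NumberTheory.EllipticCurves.JetchevLauterStein2009_kolyvaginClass_five_ne_zero_at_three)
    (K : Type) [Field K] [NumberField K] (hIQ : IsImaginaryQuadratic K)
    (hD : NumberField.discr K = -7) :
    ((⟨0, 1, 1, -2, 0⟩ : WeierstrassCurve ℤ).map (Int.castRingHom ℚ)).shaCorank 3 = 0 ∧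
      ((⟨0, 1, 1, -2, 0⟩ : WeierstrassCurve ℤ).map (Int.castRingHom ℚ)).mordellWeilRank = 2 ∧
      (((⟨0, 1, 1, -2, 0⟩ : WeierstrassCurve ℤ).map (Int.castRingHom ℚ)).quadraticTwist ((-7 : ℤ) : ℚ)).mordellWeilRank ≤ 1 ∧
      (∀ P : ((⟨0, 1, 1, -2, 0⟩ : WeierstrassCurve ℤ).map (Int.castRingHom ℚ)).toAffine.Point, 3 • P = 0 → P = 0) ∧
      (∀ x ∈ ((⟨0, 1, 1, -2, 0⟩ : WeierstrassCurve ℤ).map (Int.castRingHom ℚ)).sha, 3 • x = 0 → x = 0) ∧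
      Nat.card ↥(selmerGroup ((⟨0, 1, 1, -2, 0⟩ : WeierstrassCurve ℤ).map (Int.castRingHom ℚ)) ((3 : ℕ) : ℤ)) = 3 ^ 2 ∧
      Nat.card ↥(selmerGroup (((⟨0, 1, 1, -2, 0⟩ : WeierstrassCurve ℤ).map (Int.castRingHom ℚ)).quadraticTwist ((-7 : ℤ) : ℚ)) ((3 : ℕ) : ℤ)) ≤ 3 := by
  haveI := isElliptic_c389a1
  haveI := isGloballyMinimal_c389a1
  haveI : NeZero (((⟨0, 1, 1, -2, 0⟩ : WeierstrassCurve ℤ).map (Int.castRingHom ℚ)).conductorNorm ℤ) := neZero_conductorNorm_of_isElliptic _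
  haveI := Fact.mk (by norm_num : Nat.Prime 3)
  -- the computed bit (JLS), a datum of conductor `5`
  obtain ⟨Dt, β, ι, d, hne⟩ := hJ.1 K hIQ hD
  -- the kernel rank certificate and non-CM, moved from `Curve389a1.E` to the `ℤ`-literal handle
  have hr : 2 ≤ ((⟨0, 1, 1, -2, 0⟩ : WeierstrassCurve ℤ).map (Int.castRingHom ℚ)).mordellWeilRank := by
    rw [IntModel.map_mk_int]
    exact Curve389a1.two_le_mordellWeilRank
  have hcm : ¬ ((⟨0, 1, 1, -2, 0⟩ : WeierstrassCurve ℤ).map (Int.castRingHom ℚ)).HasCM := by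
    rw [IntModel.map_mk_int]
    exact C389a1.not_hasCM'
  -- no additive place: `gcd(c₄, Δ) = 1`, semistable
  have hsemi : ((⟨0, 1, 1, -2, 0⟩ : WeierstrassCurve ℤ).map (Int.castRingHom ℚ)).IsSemistable (𝓞 ℚ) :=
    isSemistable_of_intModel_of_isCoprime intModel
      (by rw [Int.isCoprime_iff_gcd_eq_one]; decide +kernel)
  have hadd : ∀ v : HeightOneSpectrum (𝓞 ℚ), ((⟨0, 1, 1, -2, 0⟩ : WeierstrassCurve ℤ).map (Int.castRingHom ℚ)).HasAdditiveReductionAt v → (3 : ℕ) ≠ 3 ∨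
      (((⟨0, 1, 1, -2, 0⟩ : WeierstrassCurve ℤ).map (Int.castRingHom ℚ)).kodairaSymbolAt v ≠ Literature.NumberTheory.DiophantineGeometry.KodairaSymbol.IV ∧
        ((⟨0, 1, 1, -2, 0⟩ : WeierstrassCurve ℤ).map (Int.castRingHom ℚ)).kodairaSymbolAt v ≠ Literature.NumberTheory.DiophantineGeometry.KodairaSymbol.IVstar) :=
    fun v hv ↦ absurd hv
      ((WeierstrassCurve.isSemistable_iff_forall_not_hasAdditiveReductionAt (𝓞 ℚ) _).mp hsemi v)
  -- the row on the Kodaira–Néron door ((γ) only)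
  obtain ⟨hsha, hr2, hrT, ht, hs, hSel⟩ :=
    depthRow_print_of_datum_of_intModel_certificate intModel h372 hcm hr 3 (by norm_num)
      hasSurjectiveModNGaloisRep_pow_3 K hIQ hD (by norm_num) (by norm_num) C389a1.heegner_neg7 5
      (by norm_num) (by norm_num) (by decide +kernel) (by norm_num) (by norm_num) (by norm_num)
      (by norm_num) (n := 9) C389a1.card_5 (by norm_num) (Δ₀ := 389) (by decide +kernel)
      (B := 8) (by decide +kernel) (by decide +kernel) hadd Dt β ι d hne
  refine ⟨hsha, hr2, hrT, ht, hs, hSel, ?_⟩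
  -- the twist reading `#Sel_3(E^{(−7)}) ≤ 3`
  obtain ⟨hkol, -⟩ := isKolyvaginPrime_of_intModel_certificate intModel 3 K hIQ.1 hD 5 (by norm_num)
    (by norm_num) (by decide +kernel) (by norm_num) (by norm_num) (by norm_num) (by norm_num) (n := 9)
    C389a1.card_5 (by norm_num)
  have hk₁ : ∀ q ∈ (5 : ℕ).primeFactors,
      Zhang2014.IsKolyvaginPrime (((⟨0, 1, 1, -2, 0⟩ : WeierstrassCurve ℤ).map (Int.castRingHom ℚ)).conductorNorm ℤ) ((⟨0, 1, 1, -2, 0⟩ : WeierstrassCurve ℤ).map (Int.castRingHom ℚ)) K 3 q := by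
    intro q hq
    rw [Nat.prime_five.primeFactors, Finset.mem_singleton] at hq
    exact hq ▸ hkol
  obtain ⟨c, hc, hcc⟩ := exists_conj_of_isImaginaryQuadratic K hIQ
  have hH' := satisfiesHeegnerHypothesis_conductorNorm_of_intModel intModel K hIQ.1 hD C389a1.heegner_neg7
  have hmult : ∀ v : HeightOneSpectrum (𝓞 ℚ), ((⟨0, 1, 1, -2, 0⟩ : WeierstrassCurve ℤ).map (Int.castRingHom ℚ)).HasMultiplicativeReductionAt v →
      ¬ 3 ∣ ((⟨0, 1, 1, -2, 0⟩ : WeierstrassCurve ℤ).map (Int.castRingHom ℚ)).ordMinimalDiscriminant v :=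
    not_dvd_ordMinimalDiscriminant_of_intModel_table intModel (p := 3) (Δ₀ := 389) (by decide +kernel)
      (B := 8) (by decide +kernel) (by decide +kernel)
  have hD3 : NumberField.discr K ≠ -3 := by rw [hD]; norm_num
  have hD4 : NumberField.discr K ≠ -4 := by rw [hD]; norm_num
  have hrank : (5 : ℕ).primeFactors.card + 1 ≤ ((⟨0, 1, 1, -2, 0⟩ : WeierstrassCurve ℤ).map (Int.castRingHom ℚ)).mordellWeilRank := by
    rw [Nat.prime_five.primeFactors, Finset.card_singleton]; exact hr
  obtain ⟨-, hSelT, -⟩ :=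
    natCard_selmerGroup_twist_le_of_kolyvaginClass_ne_zero_of_datum_kodairaNeron h372 hcm hIQ hD3 hD4
      hH' 3 (by norm_num) hasSurjectiveModNGaloisRep_pow_3 c hc hcc hmult hadd Nat.prime_five.prime.squarefree hk₁ d
      hne hrank
  rw [Nat.prime_five.primeFactors, Finset.card_singleton, pow_one, hD] at hSelT
  exact hSelT

end C389a1.AtThree

namespace C709a1.AtThree

/-- **JLS ROW `709a1` at `(p, d_K, ℓ) = (3, −7, 5)` ON THE KODAIRA–NÉRON DOOR: (γ) + the published bit
ONLY, with the twist reading.** Granted (γ) (Gross 1991 Prop. 3.7 (2)) and the published computation `hJ`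
(JLS 2009 Remark 3.11: a datum `d` of conductor `5` with `d.kolyvaginClass _ 1 ≠ 0`), for ANY imaginary
quadratic `K` with `d_K = −7`: `corank_{ℤ_3} Ш(E/ℚ)[3^∞] = 0`, `rank_ℤ E(ℚ) = 2`, `rank_ℤ E^{(−7)}(ℚ) ≤ 1`,
`E(ℚ)[3] = 0`, `Ш(E/ℚ)[3] = 0`, `#Sel_3(E/ℚ) = 3²`, and `#Sel_3(E^{(−7)}/ℚ) ≤ 3`. Side conditions all
kernel theorems: `3 ∈ B(E)` (`hasSurjectiveModNGaloisRep_pow_3`), non-CM, Heegner hypothesis for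
`(N, −7)`, `5` a Kolyvagin prime with `M(5) ≥ 1` (`card_5`), `2 ≤ rank` (kernel certificate), the
Kodaira–Néron table of `Δ = 709` at `3`, and NO additive place (semistable: `gcd(c₄, Δ) = 1`).
Compare g8's `jlsRow_3_neg7_5_print` (one print input more: F1). CONDITIONAL on (γ) and `hJ`;
calibration (`p = 3 < 5`), not an instance of the crux; BSD is not proved by it.
[cite: JetchevLauterStein2009, §3.6 Remark 3.11 (arXiv:0707.0032 p. 8)] [cite: GrossLMS1991, Prop. 3.7 (2), §5 (5.1)]
[cite: Kolyvagin1991MathAnn, Thm. 2.3] [cite: CremonaAlgorithms1997, Table 1 (709a1)] -/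
theorem jlsRow_3_neg7_5_kodairaNeron
    (h372 : GrossLMS1991.prop37_2_frobeniusCongruence)
    (hJ : Literature.NumberTheory.EllipticCurves.JetchevLauterStein2009_kolyvaginClass_five_ne_zero_at_three)
    (K : Type) [Field K] [NumberField K] (hIQ : IsImaginaryQuadratic K)
    (hD : NumberField.discr K = -7) :
    ((⟨0, -1, 1, -2, 0⟩ : WeierstrassCurve ℤ).map (Int.castRingHom ℚ)).shaCorank 3 = 0 ∧
      ((⟨0, -1, 1, -2, 0⟩ : WeierstrassCurve ℤ).map (Int.castRingHom ℚ)).mordellWeilRank = 2 ∧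
      (((⟨0, -1, 1, -2, 0⟩ : WeierstrassCurve ℤ).map (Int.castRingHom ℚ)).quadraticTwist ((-7 : ℤ) : ℚ)).mordellWeilRank ≤ 1 ∧
      (∀ P : ((⟨0, -1, 1, -2, 0⟩ : WeierstrassCurve ℤ).map (Int.castRingHom ℚ)).toAffine.Point, 3 • P = 0 → P = 0) ∧
      (∀ x ∈ ((⟨0, -1, 1, -2, 0⟩ : WeierstrassCurve ℤ).map (Int.castRingHom ℚ)).sha, 3 • x = 0 → x = 0) ∧
      Nat.card ↥(selmerGroup ((⟨0, -1, 1, -2, 0⟩ : WeierstrassCurve ℤ).map (Int.castRingHom ℚ)) ((3 : ℕ) : ℤ)) = 3 ^ 2 ∧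
      Nat.card ↥(selmerGroup (((⟨0, -1, 1, -2, 0⟩ : WeierstrassCurve ℤ).map (Int.castRingHom ℚ)).quadraticTwist ((-7 : ℤ) : ℚ)) ((3 : ℕ) : ℤ)) ≤ 3 := by
  haveI := isElliptic_c709a1
  haveI := isGloballyMinimal_c709a1
  haveI : NeZero (((⟨0, -1, 1, -2, 0⟩ : WeierstrassCurve ℤ).map (Int.castRingHom ℚ)).conductorNorm ℤ) := neZero_conductorNorm_of_isElliptic _
  haveI := Fact.mk (by norm_num : Nat.Prime 3)
  -- the computed bit (JLS), a datum of conductor `5`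
  obtain ⟨Dt, β, ι, d, hne⟩ := hJ.2.1 K hIQ hD
  have hr : 2 ≤ ((⟨0, -1, 1, -2, 0⟩ : WeierstrassCurve ℤ).map (Int.castRingHom ℚ)).mordellWeilRank := KernelCerts002.C709a1.two_le_rank
  have hcm : ¬ ((⟨0, -1, 1, -2, 0⟩ : WeierstrassCurve ℤ).map (Int.castRingHom ℚ)).HasCM := C709a1.not_hasCM
  -- no additive place: `gcd(c₄, Δ) = 1`, semistable
  have hsemi : ((⟨0, -1, 1, -2, 0⟩ : WeierstrassCurve ℤ).map (Int.castRingHom ℚ)).IsSemistable (𝓞 ℚ) :=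
    isSemistable_of_intModel_of_isCoprime C709a1.intModel
      (by rw [Int.isCoprime_iff_gcd_eq_one]; decide +kernel)
  have hadd : ∀ v : HeightOneSpectrum (𝓞 ℚ), ((⟨0, -1, 1, -2, 0⟩ : WeierstrassCurve ℤ).map (Int.castRingHom ℚ)).HasAdditiveReductionAt v → (3 : ℕ) ≠ 3 ∨
      (((⟨0, -1, 1, -2, 0⟩ : WeierstrassCurve ℤ).map (Int.castRingHom ℚ)).kodairaSymbolAt v ≠ Literature.NumberTheory.DiophantineGeometry.KodairaSymbol.IV ∧
        ((⟨0, -1, 1, -2, 0⟩ : WeierstrassCurve ℤ).map (Int.castRingHom ℚ)).kodairaSymbolAt v ≠ Literature.NumberTheory.DiophantineGeometry.KodairaSymbol.IVstar) :=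
    fun v hv ↦ absurd hv
      ((WeierstrassCurve.isSemistable_iff_forall_not_hasAdditiveReductionAt (𝓞 ℚ) _).mp hsemi v)
  -- the row on the Kodaira–Néron door ((γ) only)
  obtain ⟨hsha, hr2, hrT, ht, hs, hSel⟩ :=
    depthRow_print_of_datum_of_intModel_certificate C709a1.intModel h372 hcm hr 3 (by norm_num)
      hasSurjectiveModNGaloisRep_pow_3 K hIQ hD (by norm_num) (by norm_num) C709a1.heegner_neg7 5
      (by norm_num) (by norm_num) (by decide +kernel) (by norm_num) (by norm_num) (by norm_num)
      (by norm_num) (n := 9) C709a1.card_5 (by norm_num) (Δ₀ := 709) (by decide +kernel)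
      (B := 9) (by decide +kernel) (by decide +kernel) hadd Dt β ι d hne
  refine ⟨hsha, hr2, hrT, ht, hs, hSel, ?_⟩
  -- the twist reading `#Sel_3(E^{(−7)}) ≤ 3`
  obtain ⟨hkol, -⟩ := isKolyvaginPrime_of_intModel_certificate C709a1.intModel 3 K hIQ.1 hD 5 (by norm_num)
    (by norm_num) (by decide +kernel) (by norm_num) (by norm_num) (by norm_num) (by norm_num) (n := 9)
    C709a1.card_5 (by norm_num)
  have hk₁ : ∀ q ∈ (5 : ℕ).primeFactors,
      Zhang2014.IsKolyvaginPrime (((⟨0, -1, 1, -2, 0⟩ : WeierstrassCurve ℤ).map (Int.castRingHom ℚ)).conductorNorm ℤ) ((⟨0, -1, 1, -2, 0⟩ : WeierstrassCurve ℤ).map (Int.castRingHom ℚ)) K 3 q := by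
    intro q hq
    rw [Nat.prime_five.primeFactors, Finset.mem_singleton] at hq
    exact hq ▸ hkol
  obtain ⟨c, hc, hcc⟩ := exists_conj_of_isImaginaryQuadratic K hIQ
  have hH' := satisfiesHeegnerHypothesis_conductorNorm_of_intModel C709a1.intModel K hIQ.1 hD C709a1.heegner_neg7
  have hmult : ∀ v : HeightOneSpectrum (𝓞 ℚ), ((⟨0, -1, 1, -2, 0⟩ : WeierstrassCurve ℤ).map (Int.castRingHom ℚ)).HasMultiplicativeReductionAt v →
      ¬ 3 ∣ ((⟨0, -1, 1, -2, 0⟩ : WeierstrassCurve ℤ).map (Int.castRingHom ℚ)).ordMinimalDiscriminant v :=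
    not_dvd_ordMinimalDiscriminant_of_intModel_table C709a1.intModel (p := 3) (Δ₀ := 709) (by decide +kernel)
      (B := 9) (by decide +kernel) (by decide +kernel)
  have hD3 : NumberField.discr K ≠ -3 := by rw [hD]; norm_num
  have hD4 : NumberField.discr K ≠ -4 := by rw [hD]; norm_num
  have hrank : (5 : ℕ).primeFactors.card + 1 ≤ ((⟨0, -1, 1, -2, 0⟩ : WeierstrassCurve ℤ).map (Int.castRingHom ℚ)).mordellWeilRank := by
    rw [Nat.prime_five.primeFactors, Finset.card_singleton]; exact hr
  obtain ⟨-, hSelT, -⟩ :=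
    natCard_selmerGroup_twist_le_of_kolyvaginClass_ne_zero_of_datum_kodairaNeron h372 hcm hIQ hD3 hD4
      hH' 3 (by norm_num) hasSurjectiveModNGaloisRep_pow_3 c hc hcc hmult hadd Nat.prime_five.prime.squarefree hk₁ d
      hne hrank
  rw [Nat.prime_five.primeFactors, Finset.card_singleton, pow_one, hD] at hSelT
  exact hSelT

end C709a1.AtThree

namespace C718b1.AtThree

/-- **JLS ROW `718b1` at `(p, d_K, ℓ) = (3, −7, 5)` ON THE KODAIRA–NÉRON DOOR: (γ) + the published bit
ONLY, with the twist reading.** Granted (γ) (Gross 1991 Prop. 3.7 (2)) and the published computation `hJ`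
(JLS 2009 Remark 3.11: a datum `d` of conductor `5` with `d.kolyvaginClass _ 1 ≠ 0`), for ANY imaginary
quadratic `K` with `d_K = −7`: `corank_{ℤ_3} Ш(E/ℚ)[3^∞] = 0`, `rank_ℤ E(ℚ) = 2`, `rank_ℤ E^{(−7)}(ℚ) ≤ 1`,
`E(ℚ)[3] = 0`, `Ш(E/ℚ)[3] = 0`, `#Sel_3(E/ℚ) = 3²`, and `#Sel_3(E^{(−7)}/ℚ) ≤ 3`. Side conditions all
kernel theorems: `3 ∈ B(E)` (`hasSurjectiveModNGaloisRep_pow_3`), non-CM, Heegner hypothesis for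
`(N, −7)`, `5` a Kolyvagin prime with `M(5) ≥ 1` (`card_5`), `2 ≤ rank` (kernel certificate), the
Kodaira–Néron table of `Δ = 5744` at `3`, and NO additive place (semistable: `gcd(c₄, Δ) = 1`).
Compare g8's `jlsRow_3_neg7_5_print` (one print input more: F1). CONDITIONAL on (γ) and `hJ`;
calibration (`p = 3 < 5`), not an instance of the crux; BSD is not proved by it.
[cite: JetchevLauterStein2009, §3.6 Remark 3.11 (arXiv:0707.0032 p. 8)] [cite: GrossLMS1991, Prop. 3.7 (2), §5 (5.1)]
[cite: Kolyvagin1991MathAnn, Thm. 2.3] [cite: CremonaAlgorithms1997, Table 1 (718b1)] -/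
theorem jlsRow_3_neg7_5_kodairaNeron
    (h372 : GrossLMS1991.prop37_2_frobeniusCongruence)
    (hJ : Literature.NumberTheory.EllipticCurves.JetchevLauterStein2009_kolyvaginClass_five_ne_zero_at_three)
    (K : Type) [Field K] [NumberField K] (hIQ : IsImaginaryQuadratic K)
    (hD : NumberField.discr K = -7) :
    ((⟨1, 0, 1, -5, 0⟩ : WeierstrassCurve ℤ).map (Int.castRingHom ℚ)).shaCorank 3 = 0 ∧
      ((⟨1, 0, 1, -5, 0⟩ : WeierstrassCurve ℤ).map (Int.castRingHom ℚ)).mordellWeilRank = 2 ∧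
      (((⟨1, 0, 1, -5, 0⟩ : WeierstrassCurve ℤ).map (Int.castRingHom ℚ)).quadraticTwist ((-7 : ℤ) : ℚ)).mordellWeilRank ≤ 1 ∧
      (∀ P : ((⟨1, 0, 1, -5, 0⟩ : WeierstrassCurve ℤ).map (Int.castRingHom ℚ)).toAffine.Point, 3 • P = 0 → P = 0) ∧
      (∀ x ∈ ((⟨1, 0, 1, -5, 0⟩ : WeierstrassCurve ℤ).map (Int.castRingHom ℚ)).sha, 3 • x = 0 → x = 0) ∧
      Nat.card ↥(selmerGroup ((⟨1, 0, 1, -5, 0⟩ : WeierstrassCurve ℤ).map (Int.castRingHom ℚ)) ((3 : ℕ) : ℤ)) = 3 ^ 2 ∧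
      Nat.card ↥(selmerGroup (((⟨1, 0, 1, -5, 0⟩ : WeierstrassCurve ℤ).map (Int.castRingHom ℚ)).quadraticTwist ((-7 : ℤ) : ℚ)) ((3 : ℕ) : ℤ)) ≤ 3 := by
  haveI := isElliptic_c718b1
  haveI := isGloballyMinimal_c718b1
  haveI : NeZero (((⟨1, 0, 1, -5, 0⟩ : WeierstrassCurve ℤ).map (Int.castRingHom ℚ)).conductorNorm ℤ) := neZero_conductorNorm_of_isElliptic _
  haveI := Fact.mk (by norm_num : Nat.Prime 3)
  -- the computed bit (JLS), a datum of conductor `5`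
  obtain ⟨Dt, β, ι, d, hne⟩ := hJ.2.2 K hIQ hD
  have hr : 2 ≤ ((⟨1, 0, 1, -5, 0⟩ : WeierstrassCurve ℤ).map (Int.castRingHom ℚ)).mordellWeilRank := KernelCerts002.C718b1.two_le_rank
  have hcm : ¬ ((⟨1, 0, 1, -5, 0⟩ : WeierstrassCurve ℤ).map (Int.castRingHom ℚ)).HasCM := C718b1.not_hasCM
  -- no additive place: `gcd(c₄, Δ) = 1`, semistable
  have hsemi : ((⟨1, 0, 1, -5, 0⟩ : WeierstrassCurve ℤ).map (Int.castRingHom ℚ)).IsSemistable (𝓞 ℚ) :=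
    isSemistable_of_intModel_of_isCoprime C718b1.intModel
      (by rw [Int.isCoprime_iff_gcd_eq_one]; decide +kernel)
  have hadd : ∀ v : HeightOneSpectrum (𝓞 ℚ), ((⟨1, 0, 1, -5, 0⟩ : WeierstrassCurve ℤ).map (Int.castRingHom ℚ)).HasAdditiveReductionAt v → (3 : ℕ) ≠ 3 ∨
      (((⟨1, 0, 1, -5, 0⟩ : WeierstrassCurve ℤ).map (Int.castRingHom ℚ)).kodairaSymbolAt v ≠ Literature.NumberTheory.DiophantineGeometry.KodairaSymbol.IV ∧
        ((⟨1, 0, 1, -5, 0⟩ : WeierstrassCurve ℤ).map (Int.castRingHom ℚ)).kodairaSymbolAt v ≠ Literature.NumberTheory.DiophantineGeometry.KodairaSymbol.IVstar) :=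
    fun v hv ↦ absurd hv
      ((WeierstrassCurve.isSemistable_iff_forall_not_hasAdditiveReductionAt (𝓞 ℚ) _).mp hsemi v)
  -- the row on the Kodaira–Néron door ((γ) only)
  obtain ⟨hsha, hr2, hrT, ht, hs, hSel⟩ :=
    depthRow_print_of_datum_of_intModel_certificate C718b1.intModel h372 hcm hr 3 (by norm_num)
      hasSurjectiveModNGaloisRep_pow_3 K hIQ hD (by norm_num) (by norm_num) C718b1.heegner_neg7 5
      (by norm_num) (by norm_num) (by decide +kernel) (by norm_num) (by norm_num) (by norm_num)
      (by norm_num) (n := 9) C718b1.card_5 (by norm_num) (Δ₀ := 5744) (by decide +kernel)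
      (B := 18) (by decide +kernel) (by decide +kernel) hadd Dt β ι d hne
  refine ⟨hsha, hr2, hrT, ht, hs, hSel, ?_⟩
  -- the twist reading `#Sel_3(E^{(−7)}) ≤ 3`
  obtain ⟨hkol, -⟩ := isKolyvaginPrime_of_intModel_certificate C718b1.intModel 3 K hIQ.1 hD 5 (by norm_num)
    (by norm_num) (by decide +kernel) (by norm_num) (by norm_num) (by norm_num) (by norm_num) (n := 9)
    C718b1.card_5 (by norm_num)
  have hk₁ : ∀ q ∈ (5 : ℕ).primeFactors,
      Zhang2014.IsKolyvaginPrime (((⟨1, 0, 1, -5, 0⟩ : WeierstrassCurve ℤ).map (Int.castRingHom ℚ)).conductorNorm ℤ) ((⟨1, 0, 1, -5, 0⟩ : WeierstrassCurve ℤ).map (Int.castRingHom ℚ)) K 3 q := by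
    intro q hq
    rw [Nat.prime_five.primeFactors, Finset.mem_singleton] at hq
    exact hq ▸ hkol
  obtain ⟨c, hc, hcc⟩ := exists_conj_of_isImaginaryQuadratic K hIQ
  have hH' := satisfiesHeegnerHypothesis_conductorNorm_of_intModel C718b1.intModel K hIQ.1 hD C718b1.heegner_neg7
  have hmult : ∀ v : HeightOneSpectrum (𝓞 ℚ), ((⟨1, 0, 1, -5, 0⟩ : WeierstrassCurve ℤ).map (Int.castRingHom ℚ)).HasMultiplicativeReductionAt v →
      ¬ 3 ∣ ((⟨1, 0, 1, -5, 0⟩ : WeierstrassCurve ℤ).map (Int.castRingHom ℚ)).ordMinimalDiscriminant v :=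
    not_dvd_ordMinimalDiscriminant_of_intModel_table C718b1.intModel (p := 3) (Δ₀ := 5744) (by decide +kernel)
      (B := 18) (by decide +kernel) (by decide +kernel)
  have hD3 : NumberField.discr K ≠ -3 := by rw [hD]; norm_num
  have hD4 : NumberField.discr K ≠ -4 := by rw [hD]; norm_num
  have hrank : (5 : ℕ).primeFactors.card + 1 ≤ ((⟨1, 0, 1, -5, 0⟩ : WeierstrassCurve ℤ).map (Int.castRingHom ℚ)).mordellWeilRank := by
    rw [Nat.prime_five.primeFactors, Finset.card_singleton]; exact hr
  obtain ⟨-, hSelT, -⟩ :=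
    natCard_selmerGroup_twist_le_of_kolyvaginClass_ne_zero_of_datum_kodairaNeron h372 hcm hIQ hD3 hD4
      hH' 3 (by norm_num) hasSurjectiveModNGaloisRep_pow_3 c hc hcc hmult hadd Nat.prime_five.prime.squarefree hk₁ d
      hne hrank
  rw [Nat.prime_five.primeFactors, Finset.card_singleton, pow_one, hD] at hSelT
  exact hSelT

end C718b1.AtThree

/-- **The three printed depth-table bits on the Kodaira–Néron door** (JLS 2009 Prop. 3.10 / Rem. 3.11
at `(3, −7, 5)`): modulo (γ) and the published computation ONLY, for `E = 389a1`, `709a1`, `718b1` and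
ANY imaginary quadratic `K` of discriminant `−7`: `Ш(E/ℚ)[3] = 0` (every class killed by `3` is
trivial), `rank_ℤ E(ℚ) = 2`, and `#Sel_3(E^{(−7)}/ℚ) ≤ 3`. Calibration of the instrument (`p = 3 < 5`);
BSD is not proved by it. [cite: JetchevLauterStein2009, §3.6 Prop. 3.10 and Remark 3.11 (arXiv:0707.0032 p. 8)]
[cite: GrossLMS1991, Prop. 3.7 (2)] -/
theorem jlsRows_kodairaNeron
    (h372 : GrossLMS1991.prop37_2_frobeniusCongruence)
    (hJ : Literature.NumberTheory.EllipticCurves.JetchevLauterStein2009_kolyvaginClass_five_ne_zero_at_three)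
    (K : Type) [Field K] [NumberField K] (hIQ : IsImaginaryQuadratic K)
    (hD : NumberField.discr K = -7) :
    ((∀ x ∈ ((⟨0, 1, 1, -2, 0⟩ : WeierstrassCurve ℤ).map (Int.castRingHom ℚ)).sha, 3 • x = 0 → x = 0) ∧
      ((⟨0, 1, 1, -2, 0⟩ : WeierstrassCurve ℤ).map (Int.castRingHom ℚ)).mordellWeilRank = 2 ∧
      Nat.card ↥(selmerGroup ((((⟨0, 1, 1, -2, 0⟩ : WeierstrassCurve ℤ).map (Int.castRingHom ℚ))).quadraticTwist
        ((-7 : ℤ) : ℚ)) ((3 : ℕ) : ℤ)) ≤ 3) ∧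
    ((∀ x ∈ ((⟨0, -1, 1, -2, 0⟩ : WeierstrassCurve ℤ).map (Int.castRingHom ℚ)).sha, 3 • x = 0 → x = 0) ∧
      ((⟨0, -1, 1, -2, 0⟩ : WeierstrassCurve ℤ).map (Int.castRingHom ℚ)).mordellWeilRank = 2 ∧
      Nat.card ↥(selmerGroup ((((⟨0, -1, 1, -2, 0⟩ : WeierstrassCurve ℤ).map (Int.castRingHom ℚ))).quadraticTwist
        ((-7 : ℤ) : ℚ)) ((3 : ℕ) : ℤ)) ≤ 3) ∧
    ((∀ x ∈ ((⟨1, 0, 1, -5, 0⟩ : WeierstrassCurve ℤ).map (Int.castRingHom ℚ)).sha, 3 • x = 0 → x = 0) ∧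
      ((⟨1, 0, 1, -5, 0⟩ : WeierstrassCurve ℤ).map (Int.castRingHom ℚ)).mordellWeilRank = 2 ∧
      Nat.card ↥(selmerGroup ((((⟨1, 0, 1, -5, 0⟩ : WeierstrassCurve ℤ).map (Int.castRingHom ℚ))).quadraticTwist
        ((-7 : ℤ) : ℚ)) ((3 : ℕ) : ℤ)) ≤ 3) := by
  obtain ⟨-, h1r, -, -, h1s, -, h1T⟩ := C389a1.AtThree.jlsRow_3_neg7_5_kodairaNeron h372 hJ K hIQ hD
  obtain ⟨-, h2r, -, -, h2s, -, h2T⟩ := C709a1.AtThree.jlsRow_3_neg7_5_kodairaNeron h372 hJ K hIQ hD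
  obtain ⟨-, h3r, -, -, h3s, -, h3T⟩ := C718b1.AtThree.jlsRow_3_neg7_5_kodairaNeron h372 hJ K hIQ hD
  exact ⟨⟨h1s, h1r, h1T⟩, ⟨h2s, h2r, h2T⟩, ⟨h3s, h3r, h3T⟩⟩

end Summit.BirchSwinnertonDyer.BirchSwinnertonDyer.Theorems.KolyvaginDepthDoor

end
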